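import Mathlib.Dynamics.OmegaLimit
import Literature.Probability.Process.LocalRubberCompact
import Literature.Geometry.DiscreteGeometry.KissingPatterns
import Literature.MathematicalPhysics.StatisticalMechanics.LocalMatchingCompactness

/-!
# Crux `GappedShellCensus.CleanLimitExtractionR` (stmt-AtomisticToContinuum-18072), line
# `CleanLimitExtractionR_CandidateProof` — stub C₁ `stub_cleRCleanHullElement`

THE ω-LIMIT HULL EXTRACTION (Blanc–Lewin-style local limits, done in the compact pseudometric space
`LocalConfig ℝ³` of the local rubber topology, `Literature/Probability/Process/LocalRubber*`).  The
HULL of `x` is the Mathlib ω-limit of all re-rootings of the clusters `⟨range (x N)⟩`; it is closed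
(`isClosed_omegaLimit`) and re-rooting invariant (`mapsTo_omegaLimit`).  Given, as hypotheses,
(E) ball counting, (A) sitewise closedness of gapped-twelve and (B) of the fcc/hcp typing under
local-rubber limits of `δ`-separated configurations, and the pattern-typed rationing (stub D), the
radial-defect statement at one scale `a` yields a rooted hull element all of whose sites are clean:
counting with the proved hard core `LennardJonesMinimalDistance_holds` gives rooted re-rootings
gapped on `B(0, k)` for every `k`; compactness ⇒ an all-gapped rooted hull element `Y₀`; rationing
⇒ `Y₀.translate c_R` clean on `B(0, R)`; a second extraction in the closed hull ⇒ an
everywhere-clean rooted hull element.  With the hull dictionary (stub C₂) this is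
`RadialDefectsVanish → CleanLocalLimit`.
Ported from the checked crux workfile `Cruxes/CleanLimitExtractionR/SketchIdeator2.lean` (crux-ideate,
ideator 2; farm rc 0, H21 audit `proof-of-item closed:true`); the route's clauses (gapped-twelve,
fcc/hcp-typed shell, clean site) are written out verbatim — no definitions, no notations.
-/

noncomputable section

namespace Summit.AtomisticToContinuum.Crystallization.Theorems

open Filter Topology Set
open scoped Classical
open Literature.Probability.Process Literature.MathematicalPhysics.StatisticalMechanics
  Literature.Geometry.DiscreteGeometry

variable {x : (N : ℕ) → (Fin N → EuclideanSpace ℝ (Fin 3))} {Y : LocalConfig (EuclideanSpace ℝ (Fin 3))}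

/-- The hull is closed — Mathlib `isClosed_omegaLimit`. -/
theorem cleR_isClosed_hull (x : (N : ℕ) → (Fin N → EuclideanSpace ℝ (Fin 3))) : IsClosed (
    omegaLimit atTop
        (fun N (t : EuclideanSpace ℝ (Fin 3)) => (⟨Set.range (x N)⟩ : LocalConfig (EuclideanSpace ℝ (Fin 3))).translate t) Set.univ) :=
  isClosed_omegaLimit _ _ _

/-- The hull is invariant under re-rooting — Mathlib `mapsTo_omegaLimit` with the continuous map
`translate · y` (`LocalConfig.continuous_translate`) and `translate_translate`; this and
`cleR_isClosed_hull` replace the diagonal argument. -/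
theorem cleR_translate_mem_hull (hY : Y ∈ omegaLimit atTop
      (fun N (t : EuclideanSpace ℝ (Fin 3)) => (⟨Set.range (x N)⟩ : LocalConfig (EuclideanSpace ℝ (Fin 3))).translate t) Set.univ) (y : EuclideanSpace ℝ (Fin 3)) : Y.translate y ∈
          omegaLimit atTop
              (fun N (t : EuclideanSpace ℝ (Fin 3)) => (⟨Set.range (x N)⟩ : LocalConfig (EuclideanSpace ℝ (Fin 3))).translate t) Set.univ := by
  have h := mapsTo_omegaLimit (f := atTop) (ϕ := fun N (t : EuclideanSpace ℝ (Fin 3)) => (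
      (⟨Set.range (x N)⟩ : LocalConfig (EuclideanSpace ℝ (Fin 3)))).translate t)
    (ϕ' := fun N (t : EuclideanSpace ℝ (Fin 3)) => ((⟨Set.range (x N)⟩ : LocalConfig (EuclideanSpace ℝ (Fin 3)))).translate t) (s := univ) (s' := univ)
    (ga := fun t => y + t) (mapsTo_univ _ _) (gb := fun S : LocalConfig (EuclideanSpace ℝ (Fin 3)) => S.translate y)
    (fun N t => LocalConfig.translate_translate _ _ _) (LocalConfig.continuous_translate y)
  exact h hY

/-- Limits of re-rooted clusters along a subsequence lie in the hull (definition of `ω`). -/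
theorem cleR_mem_hull_of_tendsto {φ : ℕ → ℕ} (hφ : StrictMono φ) (t : ℕ → EuclideanSpace ℝ (Fin 3))
    (h : Tendsto (fun k => ((⟨Set.range (x (φ k))⟩ : LocalConfig (EuclideanSpace ℝ (Fin 3)))).translate (t k)) atTop (𝓝 Y)) : Y ∈
        omegaLimit atTop
            (fun N (t : EuclideanSpace ℝ (Fin 3)) => (⟨Set.range (x N)⟩ : LocalConfig (EuclideanSpace ℝ (Fin 3))).translate t) Set.univ := by
  simp only [omegaLimit_def, mem_iInter]
  intro u hu
  refine mem_closure_of_tendsto h ?_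
  have hev : ∀ᶠ k in atTop, φ k ∈ u := hφ.tendsto_atTop.eventually hu
  filter_upwards [hev] with k hk
  exact mem_image2_of_mem hk (mem_univ _)

/-- The bond shell of a re-rooted configuration is the re-rooted bond shell. -/
theorem cleR_shell_translate (a : ℝ) (Y : Set (EuclideanSpace ℝ (Fin 3))) (y v : EuclideanSpace ℝ (Fin 3)) :
    {w ∈ (fun z => z - v) '' Y | w ≠ y - v ∧ dist (y - v) w ≤ a * (1 + 1 / 50)} =
      (fun z => z - v) '' {w ∈ Y | w ≠ y ∧ dist y w ≤ a * (1 + 1 / 50)} := by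
  ext w'
  constructor
  · rintro ⟨⟨w, hw, rfl⟩, hne, hd⟩
    exact ⟨w, ⟨hw, fun h => hne (by rw [h]), by rwa [dist_sub_right] at hd⟩, rfl⟩
  · rintro ⟨w, ⟨hw, hne, hd⟩, rfl⟩
    exact ⟨⟨w, hw, rfl⟩, fun h => hne (sub_left_injective h), by rwa [dist_sub_right]⟩

/-- Re-rooting covariance of gapped-twelve. -/
theorem cleR_gappedTwelve_translate_iff (a : ℝ) (Y : Set (EuclideanSpace ℝ (Fin 3))) (y v : EuclideanSpace ℝ (Fin 3)) :
    ({w ∈ ((fun z => z - v) '' Y) | w ≠ (y - v) ∧ dist (y - v) w ≤ a * (1 + 1 / 50)}.ncard = 12 ∧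
          ∀ w ∈ ((fun z => z - v) '' Y), w ≠ (y - v) → a * (1 - 1 / 50) ≤ dist (y - v) w ∧
            (dist (y - v) w ≤ a * (1 + 1 / 50) ∨ a * (63 / 50) ≤ dist (y - v) w)) ↔
                ({w ∈ Y | w ≠ y ∧ dist y w ≤ a * (1 + 1 / 50)}.ncard = 12 ∧
                    ∀ w ∈ Y, w ≠ y → a * (1 - 1 / 50) ≤ dist y w ∧
                      (dist y w ≤ a * (1 + 1 / 50) ∨ a * (63 / 50) ≤ dist y w)) := by
  rw [cleR_shell_translate, Set.ncard_image_of_injective _ sub_left_injective]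
  refine and_congr Iff.rfl ⟨fun h w hw hne => ?_, fun h => ?_⟩
  · have := h (w - v) ⟨w, hw, rfl⟩ (fun h' => hne (sub_left_injective h'))
    rwa [dist_sub_right] at this
  · rintro _ ⟨w, hw, rfl⟩ hne
    rw [dist_sub_right]
    exact h w hw (fun h' => hne (by rw [h']))

/-- Re-rooting covariance of the typing clause. -/
theorem cleR_fccHcpShell_translate_iff (a : ℝ) (Y : Set (EuclideanSpace ℝ (Fin 3))) (y v : EuclideanSpace ℝ (Fin 3)) :
    (∃ T : Finset (EuclideanSpace ℝ (Fin 3)), (↑T : Set (EuclideanSpace ℝ (Fin 3))) =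
            (fun w => a⁻¹ • (w - (y - v))) '' {w ∈ ((fun z => z - v) '' Y) | w ≠ (y - v) ∧ dist (y - v) w ≤ a * (1 + 1 / 50)} ∧
          (ShellCloseTo (1 / 5) T fccKissingPattern ∨ ShellCloseTo (1 / 5) T hcpKissingPattern)) ↔
              (∃ T : Finset (EuclideanSpace ℝ (Fin 3)), (↑T : Set (EuclideanSpace ℝ (Fin 3))) =
                    (fun w => a⁻¹ • (w - y)) '' {w ∈ Y | w ≠ y ∧ dist y w ≤ a * (1 + 1 / 50)} ∧
                  (ShellCloseTo (1 / 5) T fccKissingPattern ∨ ShellCloseTo (1 / 5) T hcpKissingPattern)) := by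
  have hset : (fun w => a⁻¹ • (w - (y - v))) ''
      {w ∈ (fun z => z - v) '' Y | w ≠ y - v ∧ dist (y - v) w ≤ a * (1 + 1 / 50)} =
      (fun w => a⁻¹ • (w - y)) '' {w ∈ Y | w ≠ y ∧ dist y w ≤ a * (1 + 1 / 50)} := by
    rw [cleR_shell_translate, Set.image_image]
    congr 1
    funext w
    rw [sub_sub_sub_cancel_right]
  rw [hset]

/-- Re-rooting covariance of clean sites. -/
theorem cleR_cleanSite_translate_iff (a : ℝ) (Y : Set (EuclideanSpace ℝ (Fin 3))) (y v : EuclideanSpace ℝ (Fin 3)) :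
    (({w ∈ ((fun z => z - v) '' Y) | w ≠ (y - v) ∧ dist (y - v) w ≤ a * (1 + 1 / 50)}.ncard = 12 ∧
          ∀ w ∈ ((fun z => z - v) '' Y), w ≠ (y - v) → a * (1 - 1 / 50) ≤ dist (y - v) w ∧
            (dist (y - v) w ≤ a * (1 + 1 / 50) ∨ a * (63 / 50) ≤ dist (y - v) w)) ∧
        (∃ T : Finset (EuclideanSpace ℝ (Fin 3)), (↑T : Set (EuclideanSpace ℝ (Fin 3))) =
            (fun w => a⁻¹ • (w - (y - v))) '' {w ∈ ((fun z => z - v) '' Y) | w ≠ (y - v) ∧ dist (y - v) w ≤ a * (1 + 1 / 50)} ∧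
          (ShellCloseTo (1 / 5) T fccKissingPattern ∨ ShellCloseTo (1 / 5) T hcpKissingPattern))) ↔
              (({w ∈ Y | w ≠ y ∧ dist y w ≤ a * (1 + 1 / 50)}.ncard = 12 ∧
                  ∀ w ∈ Y, w ≠ y → a * (1 - 1 / 50) ≤ dist y w ∧
                    (dist y w ≤ a * (1 + 1 / 50) ∨ a * (63 / 50) ≤ dist y w)) ∧
                (∃ T : Finset (EuclideanSpace ℝ (Fin 3)), (↑T : Set (EuclideanSpace ℝ (Fin 3))) =
                    (fun w => a⁻¹ • (w - y)) '' {w ∈ Y | w ≠ y ∧ dist y w ≤ a * (1 + 1 / 50)} ∧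
                  (ShellCloseTo (1 / 5) T fccKissingPattern ∨ ShellCloseTo (1 / 5) T hcpKissingPattern))) :=
  and_congr (cleR_gappedTwelve_translate_iff a Y y v) (cleR_fccHcpShell_translate_iff a Y y v)

/-- Index form (the route's `RadialDefectsVanish` clause for particle `i`) ⇒ point form (gapped-twelve
on `range z`) for an injective configuration. -/
theorem cleR_gappedTwelve_range_of_idx {N : ℕ} {z : Fin N → EuclideanSpace ℝ (Fin 3)} (hz : Function.Injective z) {a : ℝ}
    {i : Fin N}
    (h : (Finset.univ.filter fun j : Fin N => j ≠ i ∧ dist (z i) (z j) ≤ a * (1 + 1 / 50)).card = 12 ∧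
      ∀ j : Fin N, j ≠ i → a * (1 - 1 / 50) ≤ dist (z i) (z j) ∧
        (dist (z i) (z j) ≤ a * (1 + 1 / 50) ∨ a * (63 / 50) ≤ dist (z i) (z j))) :
    ({w ∈ (Set.range z) | w ≠ (z i) ∧ dist (z i) w ≤ a * (1 + 1 / 50)}.ncard = 12 ∧
          ∀ w ∈ (Set.range z), w ≠ (z i) → a * (1 - 1 / 50) ≤ dist (z i) w ∧
            (dist (z i) w ≤ a * (1 + 1 / 50) ∨ a * (63 / 50) ≤ dist (z i) w)) := by
  classical
  obtain ⟨hcard, hrad⟩ := h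
  constructor
  · have hset : {w ∈ Set.range z | w ≠ z i ∧ dist (z i) w ≤ a * (1 + 1 / 50)} =
        z '' ↑(Finset.univ.filter fun j : Fin N => j ≠ i ∧ dist (z i) (z j) ≤ a * (1 + 1 / 50)) := by
      ext w
      constructor
      · rintro ⟨⟨j, rfl⟩, hne, hd⟩
        refine ⟨j, ?_, rfl⟩
        simp only [Finset.coe_filter, Finset.mem_univ, true_and, Set.mem_setOf_eq]
        exact ⟨fun h => hne (by rw [h]), hd⟩
      · rintro ⟨j, hj, rfl⟩
        simp only [Finset.coe_filter, Finset.mem_univ, true_and, Set.mem_setOf_eq] at hj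
        exact ⟨⟨j, rfl⟩, fun h => hj.1 (hz h), hj.2⟩
    rw [hset, Set.ncard_image_of_injective _ hz, Set.ncard_coe_finset, hcard]
  · rintro _ ⟨j, rfl⟩ hne
    exact hrad j (fun h => hne (by rw [h]))

/-- **Stub C₁ — THE ROOTED CLEAN HULL ELEMENT**: from the radial statement AT ONE SCALE `a` (the
clause of `RadialDefectsVanish`), ball counting (stub E), the two closedness statements (stubs A, B)
and the pattern-typed rationing (stub D's output: an all-gapped-twelve non-empty configuration has
fcc/hcp-clean balls of every radius), a ROOTED member of the hull of `x` every site of which is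
CLEAN at scale `a` (gapped-twelve with `1/5`-fcc/hcp-close rescaled shell).  Counting ⇒ rooted
re-rootings gapped on `B(0,k)`; `CompactSpace (LocalConfig ℝ³)` ⇒ limit `Y₀ ∈ hull`, all
gapped-twelve by closedness A; rationing ⇒ `Y₀.translate c_R ∈ hull` clean on `B(0,R)`; second
`tendsto_subseq`, limit in the CLOSED hull, clean everywhere by closedness A and B. -/
theorem stub_cleRCleanHullElement (x : (N : ℕ) → (Fin N → EuclideanSpace ℝ (Fin 3)))
    (hx : ∀ N, IsGroundState lennardJones (x N)) {a : ℝ} (ha : 0 < a)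
    (hRDVa : ∀ θ : ℝ, 0 < θ → ∃ᶠ N in atTop,
      (Nat.card {i : Fin N // ¬ ((Finset.univ.filter fun j : Fin N =>
          j ≠ i ∧ dist (x N i) (x N j) ≤ a * (1 + 1 / 50)).card = 12 ∧
        ∀ j : Fin N, j ≠ i → a * (1 - 1 / 50) ≤ dist (x N i) (x N j) ∧
          (dist (x N i) (x N j) ≤ a * (1 + 1 / 50) ∨ a * (63 / 50) ≤ dist (x N i) (x N j)))} : ℝ)
        ≤ θ * N)
    (hE : ∀ (x : (N : ℕ) → (Fin N → EuclideanSpace ℝ (Fin 3))) (δ : ℝ), 0 < δ →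
      (∀ N (i j : Fin N), i ≠ j → δ ≤ dist (x N i) (x N j)) → ∀ good : (N : ℕ) → Fin N → Prop,
      (∀ θ : ℝ, 0 < θ → ∃ᶠ N in atTop, (Nat.card {i : Fin N // ¬ good N i} : ℝ) ≤ θ * N) →
      ∀ k : ℝ, 0 ≤ k → ∃ᶠ N in atTop, ∃ i : Fin N, ∀ j : Fin N, dist (x N j) (x N i) ≤ k → good N j)
    (hA : ∀ (S : ℕ → LocalConfig (EuclideanSpace ℝ (Fin 3))) (Y : LocalConfig (EuclideanSpace ℝ (Fin 3))) (a δ : ℝ), 0 < a → 0 < δ →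
      (∀ k, ∀ u ∈ S k, ∀ v ∈ S k, u ≠ v → δ ≤ dist u v) → Tendsto S atTop (𝓝 Y) →
      ∀ (y : EuclideanSpace ℝ (Fin 3)) (r : ℝ), y ∈ Y → ‖y‖ < r →
      (∀ᶠ k in atTop, ∀ p ∈ S k, ‖p‖ ≤ r → ({w ∈ (S k : Set (EuclideanSpace ℝ (Fin 3))) | w ≠ p ∧ dist p w ≤ a * (1 + 1 / 50)}.ncard = 12 ∧
            ∀ w ∈ (S k : Set (EuclideanSpace ℝ (Fin 3))), w ≠ p → a * (1 - 1 / 50) ≤ dist p w ∧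
              (dist p w ≤ a * (1 + 1 / 50) ∨ a * (63 / 50) ≤ dist p w))) →
      ({w ∈ (Y : Set (EuclideanSpace ℝ (Fin 3))) | w ≠ y ∧ dist y w ≤ a * (1 + 1 / 50)}.ncard = 12 ∧
            ∀ w ∈ (Y : Set (EuclideanSpace ℝ (Fin 3))), w ≠ y → a * (1 - 1 / 50) ≤ dist y w ∧
              (dist y w ≤ a * (1 + 1 / 50) ∨ a * (63 / 50) ≤ dist y w)))
    (hB : ∀ (S : ℕ → LocalConfig (EuclideanSpace ℝ (Fin 3))) (Y : LocalConfig (EuclideanSpace ℝ (Fin 3))) (a δ : ℝ), 0 < a → 0 < δ →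
      (∀ k, ∀ u ∈ S k, ∀ v ∈ S k, u ≠ v → δ ≤ dist u v) → Tendsto S atTop (𝓝 Y) →
      ∀ (y : EuclideanSpace ℝ (Fin 3)) (r : ℝ), y ∈ Y → ‖y‖ < r →
      (∀ᶠ k in atTop, ∀ p ∈ S k, ‖p‖ ≤ r → (({w ∈ (S k : Set (EuclideanSpace ℝ (Fin 3))) | w ≠ p ∧ dist p w ≤ a * (1 + 1 / 50)}.ncard = 12 ∧
            ∀ w ∈ (S k : Set (EuclideanSpace ℝ (Fin 3))), w ≠ p → a * (1 - 1 / 50) ≤ dist p w ∧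
              (dist p w ≤ a * (1 + 1 / 50) ∨ a * (63 / 50) ≤ dist p w)) ∧
          (∃ T : Finset (EuclideanSpace ℝ (Fin 3)), (↑T : Set (EuclideanSpace ℝ (Fin 3))) =
              (fun w => a⁻¹ • (w - p)) '' {w ∈ (S k : Set (EuclideanSpace ℝ (Fin 3))) | w ≠ p ∧ dist p w ≤ a * (1 + 1 / 50)} ∧
            (ShellCloseTo (1 / 5) T fccKissingPattern ∨ ShellCloseTo (1 / 5) T hcpKissingPattern)))) →
      ({w ∈ (Y : Set (EuclideanSpace ℝ (Fin 3))) | w ≠ y ∧ dist y w ≤ a * (1 + 1 / 50)}.ncard = 12 ∧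
            ∀ w ∈ (Y : Set (EuclideanSpace ℝ (Fin 3))), w ≠ y → a * (1 - 1 / 50) ≤ dist y w ∧
              (dist y w ≤ a * (1 + 1 / 50) ∨ a * (63 / 50) ≤ dist y w)) →
      (∃ T : Finset (EuclideanSpace ℝ (Fin 3)), (↑T : Set (EuclideanSpace ℝ (Fin 3))) =
              (fun w => a⁻¹ • (w - y)) '' {w ∈ (Y : Set (EuclideanSpace ℝ (Fin 3))) | w ≠ y ∧ dist y w ≤ a * (1 + 1 / 50)} ∧
            (ShellCloseTo (1 / 5) T fccKissingPattern ∨ ShellCloseTo (1 / 5) T hcpKissingPattern)))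
    (hRat : (∀ (Y : Set (EuclideanSpace ℝ (Fin 3))) (a : ℝ), 0 < a → Y.Nonempty →
          (∀ y ∈ Y, ({w ∈ Y | w ≠ y ∧ dist y w ≤ a * (1 + 1 / 50)}.ncard = 12 ∧
              ∀ w ∈ Y, w ≠ y → a * (1 - 1 / 50) ≤ dist y w ∧
                (dist y w ≤ a * (1 + 1 / 50) ∨ a * (63 / 50) ≤ dist y w))) →
          ∀ R : ℝ, ∃ c ∈ Y, ∀ y ∈ Y, dist y c ≤ R →
            (∃ T : Finset (EuclideanSpace ℝ (Fin 3)), (↑T : Set (EuclideanSpace ℝ (Fin 3))) =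
                (fun w => a⁻¹ • (w - y)) '' {w ∈ Y | w ≠ y ∧ dist y w ≤ a * (1 + 1 / 50)} ∧
              (ShellCloseTo (1 / 5) T fccKissingPattern ∨ ShellCloseTo (1 / 5) T hcpKissingPattern)))) :
    ∃ Y ∈ omegaLimit atTop
          (fun N (t : EuclideanSpace ℝ (Fin 3)) => (⟨Set.range (x N)⟩ : LocalConfig (EuclideanSpace ℝ (Fin 3))).translate t) Set.univ, (0 : EuclideanSpace ℝ (Fin 3)) ∈ Y ∧ ∀ y ∈ Y,
      (({w ∈ (Y : Set (EuclideanSpace ℝ (Fin 3))) | w ≠ y ∧ dist y w ≤ a * (1 + 1 / 50)}.ncard = 12 ∧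
            ∀ w ∈ (Y : Set (EuclideanSpace ℝ (Fin 3))), w ≠ y → a * (1 - 1 / 50) ≤ dist y w ∧
              (dist y w ≤ a * (1 + 1 / 50) ∨ a * (63 / 50) ≤ dist y w)) ∧
          (∃ T : Finset (EuclideanSpace ℝ (Fin 3)), (↑T : Set (EuclideanSpace ℝ (Fin 3))) =
              (fun w => a⁻¹ • (w - y)) '' {w ∈ (Y : Set (EuclideanSpace ℝ (Fin 3))) | w ≠ y ∧ dist y w ≤ a * (1 + 1 / 50)} ∧
            (ShellCloseTo (1 / 5) T fccKissingPattern ∨ ShellCloseTo (1 / 5) T hcpKissingPattern))) := by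
  classical
  obtain ⟨δ, hδ, hsepGS⟩ := LennardJonesMinimalDistance_holds
  have hsep : ∀ N (i j : Fin N), i ≠ j → δ ≤ dist (x N i) (x N j) :=
    fun N i j h => hsepGS N (x N) (hx N) i j h
  have hinj : ∀ N, Function.Injective (x N) := by
    intro N i j hij
    by_contra hne
    have := hsep N i j hne
    rw [hij, dist_self] at this
    linarith
  have hsepR : ∀ N, ∀ u ∈ Set.range (x N), ∀ v ∈ Set.range (x N), u ≠ v → δ ≤ dist u v := by
    rintro N _ ⟨i, rfl⟩ _ ⟨j, rfl⟩ hne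
    exact hsep N i j fun h => hne (by rw [h])
  -- Step 1: good balls of every radius, along a strictly increasing subsequence of particle numbers
  have hfreq := fun k : ℕ => hE x δ hδ hsep
    (fun N i => (Finset.univ.filter fun j : Fin N =>
        j ≠ i ∧ dist (x N i) (x N j) ≤ a * (1 + 1 / 50)).card = 12 ∧
      ∀ j : Fin N, j ≠ i → a * (1 - 1 / 50) ≤ dist (x N i) (x N j) ∧
        (dist (x N i) (x N j) ≤ a * (1 + 1 / 50) ∨ a * (63 / 50) ≤ dist (x N i) (x N j)))
    hRDVa k (Nat.cast_nonneg k)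
  obtain ⟨Nk, hNk, hP⟩ := extraction_forall_of_frequently hfreq
  choose ik hik using hP
  -- Step 2: the rooted re-rootings `Z k`
  set Z : ℕ → LocalConfig (EuclideanSpace ℝ (Fin 3)) := fun k => ((⟨Set.range (x (Nk k))⟩ : LocalConfig (EuclideanSpace ℝ (Fin 3)))).translate (x (Nk k) (ik k)) with hZ_def
  have hZroot : ∀ k, (0 : EuclideanSpace ℝ (Fin 3)) ∈ Z k := fun k =>
    LocalConfig.zero_mem_translate (show x (Nk k) (ik k) ∈
        (⟨Set.range (x (Nk k))⟩ : LocalConfig (EuclideanSpace ℝ (Fin 3))) from ⟨ik k, rfl⟩)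
  have hZsep : ∀ k, ∀ u ∈ Z k, ∀ v ∈ Z k, u ≠ v → δ ≤ dist u v := fun k =>
    LocalConfig.separated_translate (S := (⟨Set.range (x (Nk k))⟩ : LocalConfig (EuclideanSpace ℝ (Fin 3)))) (hsepR (Nk k)) _
  have hZgood : ∀ k, ∀ p ∈ Z k, ‖p‖ ≤ k → ({w ∈ (Z k : Set (EuclideanSpace ℝ (Fin 3))) | w ≠ p ∧ dist p w ≤ a * (1 + 1 / 50)}.ncard = 12 ∧
        ∀ w ∈ (Z k : Set (EuclideanSpace ℝ (Fin 3))), w ≠ p → a * (1 - 1 / 50) ≤ dist p w ∧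
          (dist p w ≤ a * (1 + 1 / 50) ∨ a * (63 / 50) ≤ dist p w)) := by
    intro k p hp hpk
    rw [LocalConfig.mem_translate_iff] at hp
    obtain ⟨j, hj⟩ := hp
    have hdist : dist (x (Nk k) j) (x (Nk k) (ik k)) ≤ k := by
      rw [hj, dist_eq_norm, add_sub_cancel_right]
      exact hpk
    have hg := cleR_gappedTwelve_range_of_idx (hinj _) (hik k j hdist)
    have hp' : p = x (Nk k) j - x (Nk k) (ik k) := by rw [hj, add_sub_cancel_right]
    rw [hp']
    change ({w ∈ ((fun z => z - x (Nk k) (ik k)) '' Set.range (x (Nk k))) | w ≠ _ ∧ dist _ w ≤ a * (1 + 1 / 50)}.ncard = 12 ∧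
          ∀ w ∈ ((fun z => z - x (Nk k) (ik k)) '' Set.range (x (Nk k))), w ≠ _ → a * (1 - 1 / 50) ≤ dist _ w ∧
            (dist _ w ≤ a * (1 + 1 / 50) ∨ a * (63 / 50) ≤ dist _ w))
    exact (cleR_gappedTwelve_translate_iff a _ _ _).2 hg
  -- Step 3: first extraction; the limit is a rooted, separated, all-gapped-twelve hull element
  obtain ⟨Y₀, ψ, hψ, hlim⟩ := CompactSpace.tendsto_subseq Z
  have hlim2 : Tendsto (fun k => ((⟨Set.range (x (Nk (ψ k)))⟩ : LocalConfig (EuclideanSpace ℝ (Fin 3)))).translate (x (Nk (ψ k)) (ik (ψ k)))) atTop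
      (𝓝 Y₀) := hlim
  have hY₀hull : Y₀ ∈ omegaLimit atTop
        (fun N (t : EuclideanSpace ℝ (Fin 3)) => (⟨Set.range (x N)⟩ : LocalConfig (EuclideanSpace ℝ (Fin 3))).translate t) Set.univ :=
    cleR_mem_hull_of_tendsto (hNk.comp hψ) (fun k => x (Nk (ψ k)) (ik (ψ k))) hlim2
  have hY₀rs : (0 : EuclideanSpace ℝ (Fin 3)) ∈ Y₀ ∧ ∀ u ∈ Y₀, ∀ v ∈ Y₀, u ≠ v → δ ≤ dist u v :=
    (LocalConfig.isClosed_setOf_rooted_separated hδ).mem_of_tendsto hlim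
      (Eventually.of_forall fun k => ⟨hZroot _, hZsep _⟩)
  have hY₀good : ∀ y ∈ Y₀, ({w ∈ (Y₀ : Set (EuclideanSpace ℝ (Fin 3))) | w ≠ y ∧ dist y w ≤ a * (1 + 1 / 50)}.ncard = 12 ∧
        ∀ w ∈ (Y₀ : Set (EuclideanSpace ℝ (Fin 3))), w ≠ y → a * (1 - 1 / 50) ≤ dist y w ∧
          (dist y w ≤ a * (1 + 1 / 50) ∨ a * (63 / 50) ≤ dist y w)) := by
    intro y hy
    refine hA (Z ∘ ψ) Y₀ a δ ha hδ (fun k => hZsep (ψ k)) hlim y (‖y‖ + 1) hy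
      (lt_add_one ‖y‖) ?_
    have hev : ∀ᶠ k in atTop, ‖y‖ + 1 ≤ ((ψ k : ℕ) : ℝ) :=
      (tendsto_natCast_atTop_atTop.comp hψ.tendsto_atTop).eventually (eventually_ge_atTop _)
    filter_upwards [hev] with k hk p hp hpr
    exact hZgood (ψ k) p hp (hpr.trans hk)
  -- Step 4: rationing at every radius, re-rooting inside the hull, second extraction
  have hY₀ne : (Y₀ : Set (EuclideanSpace ℝ (Fin 3))).Nonempty := ⟨0, hY₀rs.1⟩
  have hcentre : ∀ m : ℕ, ∃ c ∈ (Y₀ : Set (EuclideanSpace ℝ (Fin 3))), ∀ y ∈ (Y₀ : Set (EuclideanSpace ℝ (Fin 3))), dist y c ≤ m →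
      (∃ T : Finset (EuclideanSpace ℝ (Fin 3)), (↑T : Set (EuclideanSpace ℝ (Fin 3))) =
              (fun w => a⁻¹ • (w - y)) '' {w ∈ (Y₀ : Set (EuclideanSpace ℝ (Fin 3))) | w ≠ y ∧ dist y w ≤ a * (1 + 1 / 50)} ∧
            (ShellCloseTo (1 / 5) T fccKissingPattern ∨ ShellCloseTo (1 / 5) T hcpKissingPattern)) := fun m => hRat Y₀ a ha hY₀ne hY₀good m
  choose c hc hcm using hcentre
  set W : ℕ → LocalConfig (EuclideanSpace ℝ (Fin 3)) := fun m => Y₀.translate (c m) with hW_def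
  have hWhull : ∀ m, W m ∈ omegaLimit atTop
        (fun N (t : EuclideanSpace ℝ (Fin 3)) => (⟨Set.range (x N)⟩ : LocalConfig (EuclideanSpace ℝ (Fin 3))).translate t) Set.univ := fun m => cleR_translate_mem_hull hY₀hull _
  have hWroot : ∀ m, (0 : EuclideanSpace ℝ (Fin 3)) ∈ W m := fun m => LocalConfig.zero_mem_translate (hc m)
  have hWsep : ∀ m, ∀ u ∈ W m, ∀ v ∈ W m, u ≠ v → δ ≤ dist u v := fun m =>
    LocalConfig.separated_translate hY₀rs.2 _
  have hWclean : ∀ m, ∀ p ∈ W m, ‖p‖ ≤ m → (({w ∈ (W m : Set (EuclideanSpace ℝ (Fin 3))) | w ≠ p ∧ dist p w ≤ a * (1 + 1 / 50)}.ncard = 12 ∧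
        ∀ w ∈ (W m : Set (EuclideanSpace ℝ (Fin 3))), w ≠ p → a * (1 - 1 / 50) ≤ dist p w ∧
          (dist p w ≤ a * (1 + 1 / 50) ∨ a * (63 / 50) ≤ dist p w)) ∧
      (∃ T : Finset (EuclideanSpace ℝ (Fin 3)), (↑T : Set (EuclideanSpace ℝ (Fin 3))) =
          (fun w => a⁻¹ • (w - p)) '' {w ∈ (W m : Set (EuclideanSpace ℝ (Fin 3))) | w ≠ p ∧ dist p w ≤ a * (1 + 1 / 50)} ∧
        (ShellCloseTo (1 / 5) T fccKissingPattern ∨ ShellCloseTo (1 / 5) T hcpKissingPattern))) := by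
    intro m p hp hpm
    rw [LocalConfig.mem_translate_iff] at hp
    have hd : dist (p + c m) (c m) ≤ m := by
      rw [dist_eq_norm, add_sub_cancel_right]
      exact hpm
    have h1 : ({w ∈ (Y₀ : Set (EuclideanSpace ℝ (Fin 3))) | w ≠ (p + c m) ∧ dist (p + c m) w ≤ a * (1 + 1 / 50)}.ncard = 12 ∧
          ∀ w ∈ (Y₀ : Set (EuclideanSpace ℝ (Fin 3))), w ≠ (p + c m) → a * (1 - 1 / 50) ≤ dist (p + c m) w ∧
            (dist (p + c m) w ≤ a * (1 + 1 / 50) ∨ a * (63 / 50) ≤ dist (p + c m) w)) := hY₀good _ hp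
    have h2 : (∃ T : Finset (EuclideanSpace ℝ (Fin 3)), (↑T : Set (EuclideanSpace ℝ (Fin 3))) =
            (fun w => a⁻¹ • (w - (p + c m))) '' {w ∈ (Y₀ : Set (EuclideanSpace ℝ (Fin 3))) | w ≠ (p + c m) ∧ dist (p + c m) w ≤ a * (1 + 1 / 50)} ∧
          (ShellCloseTo (1 / 5) T fccKissingPattern ∨ ShellCloseTo (1 / 5) T hcpKissingPattern)) := hcm m _ hp hd
    have hp' : p = p + c m - c m := (add_sub_cancel_right _ _).symm
    rw [hp']
    change (({w ∈ ((fun z => z - c m) '' (Y₀ : Set (EuclideanSpace ℝ (Fin 3)))) | w ≠ _ ∧ dist _ w ≤ a * (1 + 1 / 50)}.ncard = 12 ∧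
          ∀ w ∈ ((fun z => z - c m) '' (Y₀ : Set (EuclideanSpace ℝ (Fin 3)))), w ≠ _ → a * (1 - 1 / 50) ≤ dist _ w ∧
            (dist _ w ≤ a * (1 + 1 / 50) ∨ a * (63 / 50) ≤ dist _ w)) ∧
        (∃ T : Finset (EuclideanSpace ℝ (Fin 3)), (↑T : Set (EuclideanSpace ℝ (Fin 3))) =
            (fun w => a⁻¹ • (w - _)) '' {w ∈ ((fun z => z - c m) '' (Y₀ : Set (EuclideanSpace ℝ (Fin 3)))) | w ≠ _ ∧ dist _ w ≤ a * (1 + 1 / 50)} ∧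
          (ShellCloseTo (1 / 5) T fccKissingPattern ∨ ShellCloseTo (1 / 5) T hcpKissingPattern)))
    exact (cleR_cleanSite_translate_iff a _ _ _).2 ⟨h1, h2⟩
  obtain ⟨Y, ψ', hψ', hlim'⟩ := CompactSpace.tendsto_subseq W
  have hYhull : Y ∈ omegaLimit atTop
        (fun N (t : EuclideanSpace ℝ (Fin 3)) => (⟨Set.range (x N)⟩ : LocalConfig (EuclideanSpace ℝ (Fin 3))).translate t) Set.univ :=
    (cleR_isClosed_hull x).mem_of_tendsto hlim' (Eventually.of_forall fun m => hWhull _)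
  have hYrs : (0 : EuclideanSpace ℝ (Fin 3)) ∈ Y ∧ ∀ u ∈ Y, ∀ v ∈ Y, u ≠ v → δ ≤ dist u v :=
    (LocalConfig.isClosed_setOf_rooted_separated hδ).mem_of_tendsto hlim'
      (Eventually.of_forall fun m => ⟨hWroot _, hWsep _⟩)
  refine ⟨Y, hYhull, hYrs.1, fun y hy => ?_⟩
  have hev : ∀ᶠ m in atTop, ‖y‖ + 1 ≤ ((ψ' m : ℕ) : ℝ) :=
    (tendsto_natCast_atTop_atTop.comp hψ'.tendsto_atTop).eventually (eventually_ge_atTop _)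
  have hgoodW : ∀ᶠ m in atTop, ∀ p ∈ (W ∘ ψ') m, ‖p‖ ≤ ‖y‖ + 1 →
      (({w ∈ ((W ∘ ψ') m : Set (EuclideanSpace ℝ (Fin 3))) | w ≠ p ∧ dist p w ≤ a * (1 + 1 / 50)}.ncard = 12 ∧
            ∀ w ∈ ((W ∘ ψ') m : Set (EuclideanSpace ℝ (Fin 3))), w ≠ p → a * (1 - 1 / 50) ≤ dist p w ∧
              (dist p w ≤ a * (1 + 1 / 50) ∨ a * (63 / 50) ≤ dist p w)) ∧
          (∃ T : Finset (EuclideanSpace ℝ (Fin 3)), (↑T : Set (EuclideanSpace ℝ (Fin 3))) =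
              (fun w => a⁻¹ • (w - p)) '' {w ∈ ((W ∘ ψ') m : Set (EuclideanSpace ℝ (Fin 3))) | w ≠ p ∧ dist p w ≤ a * (1 + 1 / 50)} ∧
            (ShellCloseTo (1 / 5) T fccKissingPattern ∨ ShellCloseTo (1 / 5) T hcpKissingPattern))) := by
    filter_upwards [hev] with m hm p hp hpr
    exact hWclean (ψ' m) p hp (hpr.trans hm)
  have hGY := hA (W ∘ ψ') Y a δ ha hδ (fun m => hWsep (ψ' m)) hlim' y (‖y‖ + 1) hy (lt_add_one ‖y‖)
    (hgoodW.mono fun m hm p hp hpr => (hm p hp hpr).1)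
  exact ⟨hGY, hB (W ∘ ψ') Y a δ ha hδ (fun m => hWsep (ψ' m)) hlim' y (‖y‖ + 1) hy
    (lt_add_one ‖y‖) hgoodW hGY⟩

end Summit.AtomisticToContinuum.Crystallization.Theorems

end
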